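import Literature.AlgebraicGeometry.Morphisms.CechModule
import Literature.AlgebraicGeometry.Morphisms.CechH1Projective
import Literature.AlgebraicGeometry.Motives.ProjBaseChangeAny
import Literature.AlgebraicGeometry.Modules.FinitePresentationLocal
import Mathlib.Algebra.Category.ModuleCat.Sheaf.Quasicoherent
import Mathlib.AlgebraicGeometry.Modules.Sheaf
import Mathlib.Topology.KrullDimension
import Mathlib.FieldTheory.IsAlgClosed.AlgebraicClosure
import Mathlib.RingTheory.LocalRing.ResidueField.Ideal
import Mathlib.RingTheory.Spectrum.Prime.Basic
import Mathlib.LinearAlgebra.Dimension.Finrank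
import Mathlib.RingTheory.Noetherian.Basic
import HarnessLib

/-!
# Bounded families of sheaves on the fibres of `Z ⊆ 𝐏ᴺ_A → Spec A`; Langer's boundedness theorem

Named fact requested by route `HodgeConjecture/LosTransfer` (support item `SemistableTypeCriterion`,
definition `Motives.HasSemistableRepresentativesOfFixedType`): **Langer's boundedness theorem in
mixed characteristic** (Langer 2004, Thm. 4.4 = Maruyama's conjecture; Langer 2022, Thm. 3.11; over
a field Langer 2004 Thm. 4.2 = Huybrechts–Lehn Thm. 3.3.7): for a projective morphism `f : X → S`
of noetherian schemes with an `f`-very ample `𝒪(1)`, the pure `d`-dimensional coherent sheaves on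
the geometric fibres of `f` with fixed Hilbert polynomial and bounded maximal slope `μ̂_max` form a
BOUNDED family. Neither Mathlib nor the tree has the vocabulary (searched: `hilbertPoly` — Hilbert
polynomials of graded ideals only, `Literature/RingTheory/MvPolynomial`; `VeryAmple`,
`CastelnuovoMumford`, `HarderNarasimhan`, `BoundedFamily` — none; Mathlib has `Scheme.Modules`,
`SheafOfModules.IsFinitePresentation`, `Scheme.Modules.pullback`, `topologicalKrullDim`, but no
twisting sheaves, coherent cohomology or Euler characteristics), so this file builds it as REAL
definitions, in the setting used downstream and to which the printed proofs reduce (Langer 2022,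
proof of Thm. 3.11: "shrink `S` so that `X/S` embeds into `𝐏ᴺ_S`"; Huybrechts–Lehn, proof of
Thm. 3.3.7): affine noetherian base `Spec A`, closed subscheme `ι : Z ↪ 𝐏ᴺ_A` (the tree's
`Morphisms.ProjCech.PP A N = Proj A[x₀, …, x_N]`), `𝒪_Z(1) := ι^*𝒪(1)`.

* `support`, `sheafDim`, `IsPureOfDim` (Huybrechts–Lehn, Def. 1.1.1, 1.1.2) for `M : X.Modules`.
* `twistedSections ι E m` — **`Γ(Z, E(m))`, `E(m) = E ⊗ ι^*𝒪(m)`** (Hartshorne II.5) for `ι : Z → 𝐏ᴺ_K`,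
  `K` a field, ANY `𝒪_Z`-module `E`, in its Čech (cocycle) model on the cover `Z_i = Z ∩ D₊(x_i)`:
  tuples `(s_i ∈ Γ(Z_i, E))` with `s_i = (x_j/x_i)^m s_j` on `Z_i ∩ Z_j` (`𝒪(m)|_{D₊(x_i)}` is free on
  `x_i^m`, Hartshorne II Prop. 5.12 (a); sheaf axiom), the `transition` functions `(x_j/x_i)^m` being
  `ProjCech.evalRing ι {i}` of `LaurentCech.fracB K i m (x_j^m)`; `transition_self`,
  `transition_mul_transition_symm`, `transition_mul_transition` (they form a 1-cocycle of units).
  This avoids tensor products / twisting sheaves of modules, absent from Mathlib. `h0Twist = dim_K`.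
* `hilbertPolynomial ι E ∈ ℚ[T]` — the polynomial `P` with `P(m) = h⁰(Z, E(m))` for `m ≫ 0` (unique;
  JUNK VALUE `0` if there is none; for `E` coherent it exists and is `m ↦ χ(Z, E(m))`, Huybrechts–Lehn
  §1.2 and Serre's vanishing, Hartshorne III Thm. 5.2, so the junk branch never fires on the sheaves
  of the fact); `alpha P i = i!·coeffᵢ`, `muHat d P = α_{d-1}/α_d` (Huybrechts–Lehn Def. 1.6.8;
  Langer 2022 §3.3); `MaxSlopeLE ι E d μ` — `μ̂_max(E) ≤ μ`: every non-zero coherent subsheaf `F ⊆ E`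
  has `μ̂(P(F)) ≤ μ` ("`μ̂_max(E)` is the maximum of `μ̂(F)` for all subsheaves `F ⊂ E`").
* `PPmap A K N : 𝐏ᴺ_K → 𝐏ᴺ_A`, `isPullback_PPmap`; `geomFibre K ι = Z ×_{𝐏ᴺ_A} 𝐏ᴺ_K ↪ 𝐏ᴺ_K`
  (`geomFibreEmb`), `isPullback_geomFibre` (it IS `Z ×_{Spec A} Spec K`), `geomFibreTo` (the map
  `Z_K → Z_T` of a `K`-point of `T/A`), `geomPoint 𝔭 = κ(𝔭)‾`.
* `FibreSheafFamily ι`, `FibreSheafFamily.IsBounded` (Huybrechts–Lehn Def. 1.7.5, relative form: an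
  `A`-scheme `T` OF FINITE TYPE and a coherent `F` on `Z_T` such that every member on `Z_{κ(𝔭)‾}` is
  the pull-back of `F` at a `κ(𝔭)‾`-point of `T` over `𝔭`), `IsBounded.anti`, `langerFamily ι d P μ`,
  the NAMED FACT `Langer2004_boundedness` and `Langer2004_boundedness.of_le` (subfamilies).
* Elementary bricks (proved): a zero module is coherent (`isFinitePresentation_of_isZero`), pure,
  has Hilbert polynomial `0` (`hilbertPolynomial_of_isZero`) and lies in `𝒮(d; 0, μ)`
  (`langerFamily_of_isZero`); families of zero sheaves and the empty family are bounded
  (`FibreSheafFamily.isBounded_of_forall_isZero`, `FibreSheafFamily.isBounded_of_forall_not`).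
* Isomorphism invariance (proved): `twistedSectionsMap`/`twistedSectionsEquiv` (functoriality of
  `Γ(Z, E(m))`), `hilbertPolynomial_eq_of_iso`, `langerFamily_of_iso`,
  `FibreSheafFamily.IsBounded.isoClosure`.
* Finite unions (proved): `FibreSheafFamily.IsBounded.union` — `(T₁ ⊔ T₂, (j₁)_* F₁ ⊕ (j₂)_* F₂)`
  bounds `𝓕 ∪ 𝓖` (`unionInl/unionInr`, `unionCover`, `unionSheaf`; coherence of the glued sheaf by
  `Modules/FinitePresentationLocal`), `FibreSheafFamily.isBounded_iUnion` (finite index types).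

Faithfulness notes. (1) The fact fixes the whole Hilbert polynomial `P` (all `aᵢ(E)`): a special
case of Thm. 4.4 as printed (`a₀ = r`, `a₁` fixed, `aᵢ ≥ aᵢ`, `i ≥ 2`; subfamilies of bounded
families are bounded) and exactly the form of Langer 2004 Thm. 4.2 / Huybrechts–Lehn Thm. 3.3.7,
over an arbitrary noetherian affine base as Thm. 4.4 allows. (2) `𝒪_{X/S}(1)` `f`-very ample means an
`S`-immersion into some `𝐏(𝓔)`, closed since `f` is proper; boundedness is local on the noetherian
`S` and locally `𝐏(𝓔) ⊆ 𝐏ᴺ_S`, so the printed hypothesis specialises to ours. (3) `d = 0`: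
`muHat 0 P = 0` (there is no `α₋₁`); Langer's `d = 0` case carries no slope condition ("`E` is
`0`-dimensional with fixed `h⁰ = r` … bounded"), so for either sign of `μ` our family lies in his.
(4) "Subsheaf" = monomorphism `F ⟶ E` in `Z.Modules` with `F` finitely presented (= coherent on the
noetherian `Z`). (5) Geometric fibres are taken over `κ(𝔭)‾ = AlgebraicClosure κ(𝔭)` for the points
`𝔭` of `Spec A`, literally as in Def. 4.3 ("`E` on a geometric fibre `X_s`"). (6) RELATIVE
DIMENSION. Def. 4.3/Thm. 4.4 are printed for "a projective morphism of noetherian schemes OF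
RELATIVE DIMENSION `n`" (`n` enters the proof: reduction to `f` smooth and `d = n`, induction on
`n`), whereas `Langer2004_boundedness` quantifies over every closed `Z ⊆ 𝐏ᴺ_A` with no condition on
the fibre dimensions. This deviation from the printed hypotheses is deliberate and recorded here: the
general form is a routine consequence of Thm. 4.4 for the single morphism `𝐏ᴺ_A → Spec A` (relative
dimension `N`, all fibres `𝐏ᴺ_{κ(𝔭)‾}`): push a member `E` on `Z_{κ(𝔭)‾}` forward along the closed
immersion `Z_{κ(𝔭)‾} ↪ 𝐏ᴺ_{κ(𝔭)‾}` — `ι_*E` is coherent, pure of the same dimension (same support),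
has the same Hilbert polynomial (`Γ(𝐏ᴺ, (ι_*E)(m)) = Γ(Z, E(m))`, projection formula; in the Čech
model below the two spaces of cocycles coincide) and the same `μ̂_max` (the coherent subsheaves of
`ι_*E` are the `ι_*F`, `F ⊆ E`, as they are killed by the ideal of `Z`) — so the family on `Z` maps
into `𝒮_{𝐏ᴺ_A/A}(d; P, μ)`, bounded by Thm. 4.4 through some `(T, F)`; then `F|_{Z_T}` bounds the
original family (`E ≅ ι^*ι_*E ≅ ι^*(F_t) ≅ (F|_{Z_T})_t`). Equivalently one may stratify the
noetherian `Spec A` by the (constructible) fibre dimension and apply Thm. 4.4 on each stratum. The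
alternative of carrying a hypothesis `∀ 𝔭, dim Z_{κ(𝔭)‾} = n` was not adopted: it would only burden
consumers (no dimension theory of fibres in Mathlib) without changing the content.

NOT here: `χ` and higher coherent cohomology; Castelnuovo–Mumford regularity and Kleiman's
criterion (Huybrechts–Lehn 1.7.1–1.7.8); Harder–Narasimhan filtrations; (semi)stability (cf.
`Motives.IsSlopeSemistable`); the relative moduli space `M_{X/S}(P)` (Langer 2004, Thm. 0.2;
[Langer2004Mixed]) — its existence needs GIT over `S` and is a separate fact.

## References

* A. Langer, *Semistable sheaves in positive characteristic*, Ann. of Math. 159 (2004) 251–276: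
  Thm. 4.2 (p. 269), Def. 4.3 and Thm. 4.4 (p. 270), Thm. 0.2 (p. 253). [Langer2004Semistable]
* A. Langer, *On boundedness of semistable sheaves*, Doc. Math. 27 (2022) 1–16: §1, §3.3 (`aᵢ`,
  `αᵢ`, `μ̂`, `μ̂_max`, the families `𝒮_{X/S}(d; r, a₁, …, a_d, μ_max)`), Thm. 3.11 (pp. 9–10). [Langer2022]
* A. Langer, *Moduli spaces of sheaves in mixed characteristic*, Duke Math. J. 124 (2004). [Langer2004Mixed]
* D. Huybrechts, M. Lehn, *The geometry of moduli spaces of sheaves* (1997): Def. 1.1.1, 1.1.2; §1.2,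
  Lemma 1.2.1; Def. 1.6.8; Def. 1.7.5, Lemma 1.7.6, Thm. 1.7.8; Thm. 3.3.7. [HuybrechtsLehn1997]
* R. Hartshorne, *Algebraic Geometry* (1977): II.5, Definition of `𝒪_X(n)`, `ℱ(n)` and Prop. 5.12
  (p. 117); III Thm. 5.2. [Hartshorne1977]
-/


noncomputable section

open CategoryTheory CategoryTheory.Limits AlgebraicGeometry TopologicalSpace Opposite Polynomial
open Literature.AlgebraicGeometry.Morphisms Literature.AlgebraicGeometry.Morphisms.ProjCech
open Literature.Algebra.Homology.LaurentCech

universe u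

attribute [local instance] MvPolynomial.gradedAlgebra
  Literature.AlgebraicGeometry.Motives.ProjBaseChange.algebraBase

namespace Literature.AlgebraicGeometry.ModuliOfSheaves

/-! ### Support, dimension and purity of a sheaf of modules -/

section Support

variable {X : Scheme.{u}}

/-- The **support** of an `𝒪_X`-module `M`: the points `x` all of whose neighbourhoods carry a
non-zero section of `M` on some smaller open, i.e. the complement of the largest open `U` with
`M|_U = 0`. For `M` of finite type this is `Supp(M) = {x | M_x ≠ 0}`, which is closed
(Huybrechts–Lehn, Def. 1.1.1); in general it is the closure of that set. [cite: HuybrechtsLehn1997, Def. 1.1.1] -/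
def support (M : X.Modules) : Set X :=
  {x | ∀ U : X.Opens, x ∈ U → ∃ V : X.Opens, V ≤ U ∧ ∃ s : Γ(M, V), s ≠ 0}

/-- Membership in the support. [folklore] -/
theorem mem_support_iff (M : X.Modules) (x : X) :
    x ∈ support M ↔ ∀ U : X.Opens, x ∈ U → ∃ V : X.Opens, V ≤ U ∧ ∃ s : Γ(M, V), s ≠ 0 :=
  Iff.rfl

/-- A module all of whose sections vanish has empty support. [folklore] -/
theorem support_eq_empty (M : X.Modules) (h : ∀ (V : X.Opens) (s : Γ(M, V)), s = 0) :
    support M = ∅ := by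
  refine Set.eq_empty_iff_forall_notMem.mpr fun x hx ↦ ?_
  obtain ⟨V, -, s, hs⟩ := hx ⊤ trivial
  exact hs (h V s)

/-- The **dimension** `dim(M)` of an `𝒪_X`-module: the Krull dimension of its support with the
subspace topology (Huybrechts–Lehn, Def. 1.1.1; `⊥` for the zero sheaf). [cite: HuybrechtsLehn1997, Def. 1.1.1] -/
def sheafDim (M : X.Modules) : WithBot ℕ∞ :=
  topologicalKrullDim (support M)

/-- `M` is **pure of dimension `d`**: every non-zero coherent (finitely presented) subsheaf
`F ⊆ M` — a monomorphism `F ⟶ M` in `X.Modules` — has dimension exactly `d` (Huybrechts–Lehn,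
Def. 1.1.2: "`E` is pure of dimension `d` if `dim(F) = d` for all non-trivial coherent subsheaves
`F ⊂ E`"; on an integral `X` of dimension `d`, pure of dimension `d` = torsion free). [cite: HuybrechtsLehn1997, Def. 1.1.2] -/
def IsPureOfDim (M : X.Modules) (d : ℕ) : Prop :=
  ∀ (F : X.Modules) (j : F ⟶ M), Mono j → SheafOfModules.IsFinitePresentation.{u} F →
    ¬ IsZero F → sheafDim F = d

/-- A non-zero coherent sheaf pure of dimension `d` has dimension `d`. [folklore] -/
theorem IsPureOfDim.sheafDim_eq {M : X.Modules} {d : ℕ} (h : IsPureOfDim M d)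
    (hM : SheafOfModules.IsFinitePresentation.{u} M) (h0 : ¬ IsZero M) : sheafDim M = d :=
  h M (𝟙 M) inferInstance hM h0

end Support

/-! ### Twisted global sections `Γ(Z, E(m))` and the Hilbert polynomial, `Z ⊆ 𝐏ᴺ_K` -/

section Twist

variable {K : Type u} [Field K] {N : ℕ} {Z : Scheme.{u}} (ι : Z ⟶ PP K N)

/-- The transition function `(x_j / x_i)^m ∈ Γ(Z_i, 𝒪_Z)` of `ι^*𝒪(m)` on `Z_i = Z ∩ D₊(x_i)`:
the image of the degree-`0` fraction `x_j^m / x_i^m ∈ (K[x₀,…,x_N]_{x_i})₀` (`LaurentCech.fracB`)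
under `ProjCech.evalRing ι {i} : (K[x]_{x_i})₀ → Γ(Z, Z_i)` (Hartshorne II Prop. 5.12 (a): `𝒪(m)`
is free on `x_i^m` over `D₊(x_i)`, and `x_j^m = (x_j/x_i)^m x_i^m`). [cite: Hartshorne1977, II Prop. 5.12 (a)] -/
def transition (m : ℕ) (i j : Fin (N + 1)) : Sections (strZ ι) (Zop ι {i}) :=
  evalRing ι {i} (fracB K i (m : ℤ) ((MvPolynomial.X j : P K N) ^ m))

/-- `{i} ⊆ {i, j}`. [folklore] -/
theorem singleton_subset_pair_left (i j : Fin (N + 1)) : ({i} : Finset (Fin (N + 1))) ⊆ {i, j} := by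
  simp

/-- `{j} ⊆ {i, j}`. [folklore] -/
theorem singleton_subset_pair_right (i j : Fin (N + 1)) : ({j} : Finset (Fin (N + 1))) ⊆ {i, j} := by
  simp

/-- `toL (x_j^m) = xs {j} m`. [folklore] -/
theorem toL_X_pow (j : Fin (N + 1)) (m : ℕ) :
    toL K N ((MvPolynomial.X j : P K N) ^ m) = xs K {j} (m : ℤ) := by
  rw [← Xs_singleton, toL_Xs_pow]

/-- The fraction `x_j^m / x_i^m` as a Laurent monomial. [folklore] -/
theorem fracL_X_pow (i j : Fin (N + 1)) (m : ℕ) :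
    fracL K i (m : ℤ) ((MvPolynomial.X j : P K N) ^ m) = xs K {j} (m : ℤ) * xs K {i} (-(m : ℤ)) := by
  have hmem : toL K N ((MvPolynomial.X j : P K N) ^ m) ∈ Ldeg K N (m : ℤ) := by
    rw [toL_X_pow]
    simpa using xs_mem_Ldeg (A := K) ({j} : Finset (Fin (N + 1))) (m : ℤ)
  rw [fracL, hcomp_eq_self_of_toL_mem hmem, toL_X_pow]

/-- **Cocycle identity** `(x_j/x_i)^m · (x_i/x_j)^m = 1` on `Z_i ∩ Z_j`: the transition functions of
`ι^*𝒪(m)` are mutually inverse on overlaps. [folklore] -/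
theorem transition_mul_transition_symm (m : ℕ) (i j : Fin (N + 1)) :
    Sections.res (strZ ι) (Zop_mono ι (singleton_subset_pair_left i j)) (transition ι m i j) *
      Sections.res (strZ ι) (Zop_mono ι (singleton_subset_pair_right i j)) (transition ι m j i) =
        1 := by
  rw [transition, transition, ← evalRing_res ι (singleton_subset_pair_left i j),
    ← evalRing_res ι (singleton_subset_pair_right i j), ← map_mul, ← map_one (evalRing ι {i, j})]
  congr 1
  apply Subtype.ext
  change fracL K i (m : ℤ) ((MvPolynomial.X j : P K N) ^ m) *
    fracL K j (m : ℤ) ((MvPolynomial.X i : P K N) ^ m) = 1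
  rw [fracL_X_pow, fracL_X_pow, mul_assoc, ← mul_assoc (xs K {i} _), xs_neg_mul_xs, one_mul,
    xs_mul_xs_neg]

/-- `{i} ⊆ {i, j, k}`. [folklore] -/
theorem singleton_subset_triple_left (i j k : Fin (N + 1)) :
    ({i} : Finset (Fin (N + 1))) ⊆ {i, j, k} := by
  simp

/-- `{j} ⊆ {i, j, k}`. [folklore] -/
theorem singleton_subset_triple_mid (i j k : Fin (N + 1)) :
    ({j} : Finset (Fin (N + 1))) ⊆ {i, j, k} := by
  simp

/-- **Čech 1-cocycle identity** `(x_j/x_i)^m · (x_k/x_j)^m = (x_k/x_i)^m` on `Z_i ∩ Z_j ∩ Z_k`: together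
with `transition_self` and `transition_mul_transition_symm`, the `transition ι m i j` form a 1-cocycle
of units on the cover `(Z_i)`, the cocycle of the line bundle `ι^*𝒪(m)`. [folklore] -/
theorem transition_mul_transition (m : ℕ) (i j k : Fin (N + 1)) :
    Sections.res (strZ ι) (Zop_mono ι (singleton_subset_triple_left i j k)) (transition ι m i j) *
      Sections.res (strZ ι) (Zop_mono ι (singleton_subset_triple_mid i j k)) (transition ι m j k) =
        Sections.res (strZ ι) (Zop_mono ι (singleton_subset_triple_left i j k))
          (transition ι m i k) := by
  rw [transition, transition, transition, ← evalRing_res ι (singleton_subset_triple_left i j k),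
    ← evalRing_res ι (singleton_subset_triple_mid i j k),
    ← evalRing_res ι (singleton_subset_triple_left i j k), ← map_mul]
  congr 1
  apply Subtype.ext
  change fracL K i (m : ℤ) ((MvPolynomial.X j : P K N) ^ m) *
    fracL K j (m : ℤ) ((MvPolynomial.X k : P K N) ^ m) = fracL K i (m : ℤ) ((MvPolynomial.X k : P K N) ^ m)
  rw [fracL_X_pow, fracL_X_pow, fracL_X_pow]
  calc xs K {j} (m : ℤ) * xs K {i} (-(m : ℤ)) * (xs K {k} (m : ℤ) * xs K {j} (-(m : ℤ)))
      = xs K {j} (m : ℤ) * xs K {j} (-(m : ℤ)) * (xs K {k} (m : ℤ) * xs K {i} (-(m : ℤ))) := by ring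
    _ = xs K {k} (m : ℤ) * xs K {i} (-(m : ℤ)) := by rw [xs_mul_xs_neg, one_mul]

/-- `x_i^m / x_i^m = 1`: the transition function from a chart to itself is `1`. [folklore] -/
@[simp] theorem transition_self (m : ℕ) (i : Fin (N + 1)) : transition ι m i i = 1 := by
  rw [transition, ← map_one (evalRing ι {i})]
  congr 1
  apply Subtype.ext
  change fracL K i (m : ℤ) ((MvPolynomial.X i : P K N) ^ m) = 1
  rw [fracL_X_pow, xs_mul_xs_neg]

variable (E : Z.Modules)

/-- **`Γ(Z, E(m))` as a `K`-vector space**, `E(m) = E ⊗ ι^*𝒪_{𝐏ᴺ_K}(m)` (Hartshorne II.5,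
Definition before Prop. 5.12), in the Čech model on the standard affine cover `Z_i = Z ∩ D₊(x_i)`:
the tuples `(s_i ∈ Γ(Z_i, E))_{i = 0, …, N}` with `s_i|_{Z_i ∩ Z_j} = (x_j/x_i)^m · s_j|_{Z_i ∩ Z_j}`
for all `i, j` (`Z_i ∩ Z_j = Z_{{i,j}} = Z ∩ D₊(x_i x_j)`). Since `E(m)|_{Z_i} ≅ E|_{Z_i}` by
`e ↦ e ⊗ x_i^m` and `E(m)` is a sheaf, `σ ↦ (s_i)` with `σ|_{Z_i} = s_i ⊗ x_i^m` is a `K`-linear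
isomorphism of `Γ(Z, E(m))` onto this space, for every `𝒪_Z`-module `E`. The `K`-structure is
that of `Morphisms.MSections` (through `K → Γ(Z_i, 𝒪_Z)`). [cite: Hartshorne1977, II.5 Definition before Prop. 5.12 and Prop. 5.12 (a)] -/
def twistedSections (m : ℕ) :
    Submodule K (∀ i : Fin (N + 1), MSections (strZ ι) E (Zop ι {i})) where
  carrier := {s | ∀ i j : Fin (N + 1),
    MSections.res (strZ ι) E (Zop_mono ι (singleton_subset_pair_left i j)) (s i) =
      Sections.res (strZ ι) (Zop_mono ι (singleton_subset_pair_left i j)) (transition ι m i j) •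
        MSections.res (strZ ι) E (Zop_mono ι (singleton_subset_pair_right i j)) (s j)}
  zero_mem' i j := by simp
  add_mem' {s t} hs ht i j := by
    simp only [Pi.add_apply, map_add, smul_add, hs i j, ht i j]
  smul_mem' c s hs i j := by
    simp only [Pi.smul_apply, LinearMap.map_smul, hs i j, smul_comm c]

/-- Membership in `twistedSections`: the cocycle condition `s_i = (x_j/x_i)^m s_j` on `Z_i ∩ Z_j`. [folklore] -/
theorem mem_twistedSections_iff (m : ℕ) (s : ∀ i : Fin (N + 1), MSections (strZ ι) E (Zop ι {i})) :
    s ∈ twistedSections ι E m ↔ ∀ i j : Fin (N + 1),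
      MSections.res (strZ ι) E (Zop_mono ι (singleton_subset_pair_left i j)) (s i) =
        Sections.res (strZ ι) (Zop_mono ι (singleton_subset_pair_left i j)) (transition ι m i j) •
          MSections.res (strZ ι) E (Zop_mono ι (singleton_subset_pair_right i j)) (s j) :=
  Iff.rfl

/-- **`h⁰(Z, E(m)) = dim_K Γ(Z, E(m))`** (`Module.finrank`; junk value `0` if infinite-dimensional,
which does not happen for `E` coherent, Hartshorne III Thm. 5.2 (a)). [cite: HuybrechtsLehn1997, §1.2 (definition of hⁱ and of the Hilbert polynomial)] -/
def h0Twist (m : ℕ) : ℕ :=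
  Module.finrank K (twistedSections ι E m)

open Filter in
/-- `P ∈ ℚ[T]` **is a Hilbert polynomial of `E`**: `h⁰(Z, E(m)) = P(m)` for all `m ≫ 0`. For `E`
coherent, `χ(E(m))` is a polynomial in `m` and equals `h⁰(E(m))` for `m ≫ 0` by Serre's vanishing
theorem, so this holds exactly for `P(E) : m ↦ χ(E ⊗ 𝒪(m))` (Huybrechts–Lehn §1.2, Lemma 1.2.1;
Hartshorne III Thm. 5.2 (b), Ex. 5.2). [cite: HuybrechtsLehn1997, §1.2 and Lemma 1.2.1] -/
def IsHilbertPolynomialOf (P : ℚ[X]) : Prop :=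
  ∀ᶠ m : ℕ in atTop, (h0Twist ι E m : ℚ) = P.eval (m : ℚ)

/-- Two Hilbert polynomials of the same sheaf coincide (polynomials over `ℚ` agreeing at
infinitely many integers are equal). [folklore] -/
theorem IsHilbertPolynomialOf.unique {P Q : ℚ[X]} (hP : IsHilbertPolynomialOf ι E P)
    (hQ : IsHilbertPolynomialOf ι E Q) : P = Q := by
  obtain ⟨B, hB⟩ := Filter.eventually_atTop.1
    ((hP.and hQ).mono fun m hm ↦ hm.1.symm.trans hm.2)
  refine Polynomial.eq_of_infinite_eval_eq P Q
    (Set.infinite_of_injective_forall_mem (f := fun n : ℕ ↦ ((B + n : ℕ) : ℚ)) ?_ ?_)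
  · intro a b h
    simpa using h
  · exact fun n ↦ hB (B + n) (Nat.le_add_right B n)

open Classical in
/-- **The Hilbert polynomial `P(E) ∈ ℚ[T]`** of an `𝒪_Z`-module `E` on `Z ⊆ 𝐏ᴺ_K` with respect to
`𝒪_Z(1) = ι^*𝒪(1)`: the unique polynomial with `P(E)(m) = h⁰(Z, E(m))` for `m ≫ 0`, i.e. for `E`
coherent `P(E, m) = χ(E ⊗ 𝒪(m))` (Huybrechts–Lehn §1.2); JUNK VALUE `0` when `h⁰(E(m))` is not
eventually polynomial (never the case for coherent `E` on the projective `K`-scheme `Z`). [cite: HuybrechtsLehn1997, §1.2 and Lemma 1.2.1] -/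
def hilbertPolynomial : ℚ[X] :=
  if h : ∃ P : ℚ[X], IsHilbertPolynomialOf ι E P then h.choose else 0

/-- The Hilbert polynomial is the polynomial interpolating `h⁰(E(m))` for `m ≫ 0`, when there is one. [folklore] -/
theorem hilbertPolynomial_eq {P : ℚ[X]} (hP : IsHilbertPolynomialOf ι E P) :
    hilbertPolynomial ι E = P := by
  have h : ∃ P : ℚ[X], IsHilbertPolynomialOf ι E P := ⟨P, hP⟩
  rw [hilbertPolynomial, dif_pos h]
  exact IsHilbertPolynomialOf.unique ι E h.choose_spec hP

/-- The junk branch: no interpolating polynomial, Hilbert polynomial `0`. [folklore] -/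
theorem hilbertPolynomial_of_not_exists (h : ¬ ∃ P : ℚ[X], IsHilbertPolynomialOf ι E P) :
    hilbertPolynomial ι E = 0 := by
  rw [hilbertPolynomial, dif_neg h]

/-- The coefficients `αᵢ(P) = i! · (coefficient of Tⁱ)`, so that `P = Σᵢ αᵢ(P) Tⁱ/i!`
(Huybrechts–Lehn, display after Lemma 1.2.1; `α_d(E) > 0` is the multiplicity of a `d`-dimensional
`E ≠ 0`). [cite: HuybrechtsLehn1997, §1.2 (display after Lemma 1.2.1)] -/
def alpha (P : ℚ[X]) (i : ℕ) : ℚ :=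
  (i.factorial : ℚ) * P.coeff i

/-- **The generalised slope `μ̂(P) = α_{d-1}(P)/α_d(P)`** of a polynomial regarded as of degree `d`
(Huybrechts–Lehn, Def. 1.6.8; Langer 2022, §3.3: `μ̂(E) = a₁(E)/a₀(E) + (d+1)/2` in terms of the
binomial coefficients `aᵢ`). Convention `μ̂ = 0` for `d = 0` (no `α₋₁`). [cite: HuybrechtsLehn1997, Def. 1.6.8] [cite: Langer2022, §3.3] -/
def muHat : ℕ → ℚ[X] → ℚ
  | 0, _ => 0
  | d + 1, P => alpha P d / alpha P (d + 1)

/-- `μ̂` in degree `0` is `0` by convention. [folklore] -/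
@[simp] theorem muHat_zero (P : ℚ[X]) : muHat 0 P = 0 := rfl

/-- `μ̂` in degree `d + 1`. [folklore] -/
@[simp] theorem muHat_succ (d : ℕ) (P : ℚ[X]) : muHat (d + 1) P = alpha P d / alpha P (d + 1) := rfl

/-- **`μ̂_max(E) ≤ μ`** for `E` regarded as `d`-dimensional: every non-zero coherent subsheaf
`F ⊆ E` (monomorphism from a finitely presented `F`) has `μ̂(P(F)) ≤ μ` (Langer 2022, §3.3:
"`μ̂_max(E)` is the maximum of `μ̂(F)` for all subsheaves `F ⊂ E`"; Huybrechts–Lehn, Def. 1.6.8 /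
1.6.9; for `E` pure of dimension `d` every such `F` is `d`-dimensional with `α_d(F) > 0`). [cite: Langer2022, §3.3 (definition of μ̂_max before Thm. 3.11)] -/
def MaxSlopeLE (d : ℕ) (μ : ℚ) : Prop :=
  ∀ (F : Z.Modules) (j : F ⟶ E), Mono j → SheafOfModules.IsFinitePresentation.{u} F →
    ¬ IsZero F → muHat d (hilbertPolynomial ι F) ≤ μ

end Twist

/-! ### Geometric fibres of `Z ⊆ 𝐏ᴺ_A` -/

section Fibres

open Literature.AlgebraicGeometry.Motives.ProjBaseChangeRing

variable (A : Type u) [CommRing A] (K : Type u) [CommRing K] [Algebra A K] (N : ℕ)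

/-- The base-change morphism `𝐏ᴺ_K → 𝐏ᴺ_A` of an `A`-algebra `K` (`Proj` of `A[x] → K[x]`). [folklore] -/
def PPmap : PP K N ⟶ PP A N :=
  Proj.map (mapGraded A K (Fin (N + 1))) (irrelevant_le_map A K (Fin (N + 1)))

/-- `𝐏ᴺ_K → 𝐏ᴺ_A → Spec A` is `𝐏ᴺ_K → Spec K → Spec A`. [folklore] -/
theorem PPmap_toSpec :
    PPmap A K N ≫ toSpec A N = toSpec K N ≫ Spec.map (CommRingCat.ofHom (algebraMap A K)) :=
  (isPullback_projMap' A K (n := N)).w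

/-- **`𝐏ᴺ_K = 𝐏ᴺ_A ×_{Spec A} Spec K`** (the tree's `ProjBaseChangeRing.isPullback_projMap'`;
Görtz–Wedhorn I (13.9)). [folklore] -/
theorem isPullback_PPmap :
    IsPullback (PPmap A K N) (toSpec K N) (toSpec A N)
      (Spec.map (CommRingCat.ofHom (algebraMap A K))) :=
  isPullback_projMap' A K (n := N)

variable {A N} {Z : Scheme.{u}} (ι : Z ⟶ PP A N)

/-- The fibre `Z_K = Z ×_{𝐏ᴺ_A} 𝐏ᴺ_K` of `Z ⊆ 𝐏ᴺ_A` over the `A`-algebra `K`; for `K` an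
algebraically closed field this is the GEOMETRIC FIBRE `Z ×_{Spec A} Spec K` of `Z → Spec A`
(`isPullback_geomFibre`). [folklore] -/
abbrev geomFibre : Scheme.{u} := pullback ι (PPmap A K N)

/-- The closed immersion `Z_K ↪ 𝐏ᴺ_K` (base change of `ι`; Mathlib infers `IsClosedImmersion`). [folklore] -/
abbrev geomFibreEmb : geomFibre K ι ⟶ PP K N := pullback.snd ι (PPmap A K N)

/-- **`Z_K` is the fibre product `Z ×_{Spec A} Spec K`**: the square `Z_K → Spec K`, `Z_K → Z`,
`Spec K → Spec A`, `Z → Spec A` is cartesian (pasting `Z_K = Z ×_{𝐏ᴺ_A} 𝐏ᴺ_K` with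
`𝐏ᴺ_K = 𝐏ᴺ_A ×_A Spec K`). [folklore] -/
theorem isPullback_geomFibre :
    IsPullback (geomFibreEmb K ι ≫ toSpec K N) (pullback.fst ι (PPmap A K N))
      (Spec.map (CommRingCat.ofHom (algebraMap A K))) (strZ ι) :=
  (IsPullback.of_hasPullback ι (PPmap A K N)).flip.paste_horiz (isPullback_PPmap A K N).flip

variable {K}

/-- The canonical morphism `Z_K → Z_T = Z ×_{Spec A} T` induced by a `K`-point `t : Spec K → T` of an
`A`-scheme `g : T → Spec A` lying over `Spec K → Spec A`. [folklore] -/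
def geomFibreTo {T : Scheme.{u}} {g : T ⟶ Spec (.of A)} (t : Spec (.of K) ⟶ T)
    (ht : t ≫ g = Spec.map (CommRingCat.ofHom (algebraMap A K))) :
    geomFibre K ι ⟶ pullback (strZ ι) g :=
  pullback.lift (pullback.fst ι (PPmap A K N)) (geomFibreEmb K ι ≫ toSpec K N ≫ t) (by
    rw [Category.assoc, Category.assoc, ht, ← PPmap_toSpec, pullback.condition_assoc])

/-- `geomFibreTo` followed by the projection to `Z` is the projection `Z_K → Z`. [folklore] -/
@[simp] theorem geomFibreTo_fst {T : Scheme.{u}} {g : T ⟶ Spec (.of A)} (t : Spec (.of K) ⟶ T)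
    (ht : t ≫ g = Spec.map (CommRingCat.ofHom (algebraMap A K))) :
    geomFibreTo ι t ht ≫ pullback.fst (strZ ι) g = pullback.fst ι (PPmap A K N) :=
  pullback.lift_fst _ _ _

/-- `geomFibreTo` followed by the projection to `T` is `Z_K → Spec K → T`. [folklore] -/
@[simp] theorem geomFibreTo_snd {T : Scheme.{u}} {g : T ⟶ Spec (.of A)} (t : Spec (.of K) ⟶ T)
    (ht : t ≫ g = Spec.map (CommRingCat.ofHom (algebraMap A K))) :
    geomFibreTo ι t ht ≫ pullback.snd (strZ ι) g = geomFibreEmb K ι ≫ toSpec K N ≫ t :=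
  pullback.lift_snd _ _ _

variable (A) in
/-- The algebraically closed field `κ(𝔭)‾ = AlgebraicClosure κ(𝔭)` of the geometric fibre over a
point `𝔭 ∈ Spec A` (an `A`-algebra through `A → κ(𝔭)`). [folklore] -/
abbrev geomPoint (𝔭 : PrimeSpectrum A) : Type u := AlgebraicClosure 𝔭.asIdeal.ResidueField

end Fibres

/-! ### Families of sheaves on the geometric fibres; boundedness -/

section Bounded

variable {A : Type u} [CommRing A] {N : ℕ} {Z : Scheme.{u}} (ι : Z ⟶ PP A N)

/-- A (set-theoretic) **family of sheaves on the geometric fibres** of `Z ⊆ 𝐏ᴺ_A → Spec A`: for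
every point `𝔭 ∈ Spec A`, a class of `𝒪`-modules on the geometric fibre `Z_{κ(𝔭)‾}`
(Huybrechts–Lehn, Def. 1.7.5 "family of isomorphism classes of coherent sheaves … set-theoretical
meaning"; Langer 2004, Def. 4.3: "the family of the classes of coherent sheaves on the fibres of `f`
such that `E` on a geometric fibre `X_s` is a member if …"). [cite: HuybrechtsLehn1997, Def. 1.7.5] [cite: Langer2004Semistable, Def. 4.3] -/
def FibreSheafFamily : Type (u + 1) :=
  ∀ ⦃𝔭 : PrimeSpectrum A⦄, (geomFibre (geomPoint A 𝔭) ι).Modules → Prop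

variable {ι}

/-- **Bounded family** (Huybrechts–Lehn, Def. 1.7.5, relative form as used in Langer 2004, §4): there
exist an `A`-scheme `g : T → Spec A` OF FINITE TYPE (locally of finite type and quasi-compact) and a
coherent (finitely presented) sheaf `F` on `Z_T = Z ×_{Spec A} T` such that every member `E` of the
family on a geometric fibre `Z_{κ(𝔭)‾}` is isomorphic to the pull-back of `F` along the canonical map
`Z_{κ(𝔭)‾} → Z_T` of some `κ(𝔭)‾`-point `t : Spec κ(𝔭)‾ → T` over `A` (`E ≅ F_t ⊗_{κ(t)} κ(𝔭)‾`).
No `T`-flatness of `F` is demanded (Huybrechts–Lehn, Def. 1.7.5; Langer 2022, §1 adds "`S`-flat", an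
equivalent requirement by flattening stratification, and the weaker clause only weakens the fact). [cite: HuybrechtsLehn1997, Def. 1.7.5] -/
def FibreSheafFamily.IsBounded (𝓕 : FibreSheafFamily ι) : Prop :=
  ∃ (T : Scheme.{u}) (g : T ⟶ Spec (.of A)), LocallyOfFiniteType g ∧ QuasiCompact g ∧
    ∃ F : (pullback (strZ ι) g).Modules, SheafOfModules.IsFinitePresentation.{u} F ∧
      ∀ ⦃𝔭 : PrimeSpectrum A⦄ (E : (geomFibre (geomPoint A 𝔭) ι).Modules), 𝓕 E →
        ∃ (t : Spec (.of (geomPoint A 𝔭)) ⟶ T)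
          (ht : t ≫ g = Spec.map (CommRingCat.ofHom (algebraMap A (geomPoint A 𝔭)))),
          Nonempty (E ≅ (Scheme.Modules.pullback (geomFibreTo ι t ht)).obj F)

/-- A subfamily of a bounded family is bounded. [folklore] -/
theorem FibreSheafFamily.IsBounded.anti {𝓕 𝓖 : FibreSheafFamily ι}
    (hle : ∀ ⦃𝔭 : PrimeSpectrum A⦄ (E : (geomFibre (geomPoint A 𝔭) ι).Modules), 𝓕 E → 𝓖 E)
    (h𝓖 : 𝓖.IsBounded) : 𝓕.IsBounded := by
  obtain ⟨T, g, hg, hq, F, hF, h⟩ := h𝓖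
  exact ⟨T, g, hg, hq, F, hF, fun 𝔭 E hE ↦ h E (hle E hE)⟩

variable (ι)

/-- **Langer's family with fixed Hilbert polynomial** `𝒮_{Z/A}(d; P, μ)`: the coherent sheaves `E`
on the geometric fibres `Z_{κ(𝔭)‾} ⊆ 𝐏ᴺ_{κ(𝔭)‾}`, `𝔭 ∈ Spec A`, which are pure of dimension `d`, have
Hilbert polynomial `P` with respect to `𝒪(1)`, and `μ̂_max(E) ≤ μ` (Langer 2004, Def. 4.3 with all `aᵢ` fixed; Langer 2022,
§3.3; Huybrechts–Lehn, Thm. 3.3.7). [cite: Langer2004Semistable, Def. 4.3] [cite: HuybrechtsLehn1997, Thm. 3.3.7] -/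
def langerFamily (d : ℕ) (P : ℚ[X]) (μ : ℚ) : FibreSheafFamily ι :=
  fun 𝔭 E ↦ SheafOfModules.IsFinitePresentation.{u} E ∧ IsPureOfDim E d ∧
    hilbertPolynomial (geomFibreEmb (geomPoint A 𝔭) ι) E = P ∧
      MaxSlopeLE (geomFibreEmb (geomPoint A 𝔭) ι) E d μ

/-- Membership in Langer's family. [folklore] -/
theorem langerFamily_iff (d : ℕ) (P : ℚ[X]) (μ : ℚ) {𝔭 : PrimeSpectrum A}
    (E : (geomFibre (geomPoint A 𝔭) ι).Modules) :
    langerFamily ι d P μ E ↔ SheafOfModules.IsFinitePresentation.{u} E ∧ IsPureOfDim E d ∧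
      hilbertPolynomial (geomFibreEmb (geomPoint A 𝔭) ι) E = P ∧
        MaxSlopeLE (geomFibreEmb (geomPoint A 𝔭) ι) E d μ :=
  Iff.rfl

end Bounded

/-! ### The named fact -/

/-- **Langer's boundedness theorem (Maruyama's conjecture), fixed Hilbert polynomial, affine
noetherian base** (Langer 2004, Thm. 4.4: for `f : X → S` a projective morphism of noetherian
schemes with `𝒪_{X/S}(1)` `f`-very ample, the family `𝒮_{X/S}(d; r, a₁, …, a_d, μ_max)` of classes of
coherent sheaves `E` on the geometric fibres of `f`, pure of dimension `d`, with `μ_max(E) ≤ μ_max`,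
`a₀(E) = r`, `a₁(E) = a₁`, `aᵢ(E) ≥ aᵢ` (`i ≥ 2`) is bounded; Langer 2022, Thm. 3.11; Langer 2004,
Thm. 4.2 and Huybrechts–Lehn, Thm. 3.3.7 for the fixed-`P` form over a field). Here: for every
noetherian ring `A`, every closed subscheme `ι : Z ↪ 𝐏ᴺ_A` (so `Z → Spec A` is projective with the
`f`-very ample `ι^*𝒪(1)`), every `d`, `P ∈ ℚ[T]` and `μ ∈ ℚ`, the family of coherent sheaves on the
geometric fibres `Z_{κ(𝔭)‾}` (`𝔭 ∈ Spec A`) that are pure of dimension `d` with Hilbert polynomial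
`P` and `μ̂_max ≤ μ` is bounded — a special case of Thm. 4.4 (all `aᵢ` fixed; module docstring,
Faithfulness notes (1)–(5)) EXCEPT in one hypothesis, recorded as Faithfulness note (6) there: the
printed theorem assumes `f` "of relative dimension `n`", while here `Z ⊆ 𝐏ᴺ_A` is an arbitrary closed
subscheme; this general form follows from Thm. 4.4 for `𝐏ᴺ_A → Spec A` (relative dimension `N`) by
pushing members forward along `Z_{κ(𝔭)‾} ↪ 𝐏ᴺ_{κ(𝔭)‾}` (purity, Hilbert polynomial and `μ̂_max` are
unchanged) and restricting the bounding sheaf to `Z_T`. In particular slope- or Gieseker-semistable sheaves of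
fixed Hilbert polynomial (`μ̂_max = μ̂(P)`) on the fibres form a bounded family, whence relative moduli
spaces of finite type (Langer 2004, Thm. 0.2, not vendored here). [cite: Langer2004Semistable, Thm. 4.4 and Def. 4.3 (p. 270), Thm. 4.2 (p. 269)] [cite: Langer2022, Thm. 3.11] -/
def Langer2004_boundedness : Prop :=
  ∀ ⦃A : Type u⦄ [CommRing A] [IsNoetherianRing A] ⦃N : ℕ⦄ ⦃Z : Scheme.{u}⦄ (ι : Z ⟶ PP A N)
    [IsClosedImmersion ι] (d : ℕ) (P : ℚ[X]) (μ : ℚ), (langerFamily ι d P μ).IsBounded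

/-- Langer's theorem bounds every subfamily of `𝒮_{Z/A}(d; P, μ)` (e.g. the semistable sheaves of
Hilbert polynomial `P`, with `μ = μ̂(P)`). [folklore] -/
theorem Langer2004_boundedness.of_le (h : Langer2004_boundedness.{u}) {A : Type u} [CommRing A]
    [IsNoetherianRing A] {N : ℕ} {Z : Scheme.{u}} (ι : Z ⟶ PP A N) [IsClosedImmersion ι] (d : ℕ)
    (P : ℚ[X]) (μ : ℚ) {𝓕 : FibreSheafFamily ι}
    (hle : ∀ ⦃𝔭 : PrimeSpectrum A⦄ (E : (geomFibre (geomPoint A 𝔭) ι).Modules),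
      𝓕 E → langerFamily ι d P μ E) : 𝓕.IsBounded :=
  (h ι d P μ).anti hle

/-! ### Elementary boundedness facts: zero sheaves and the empty family

First (elementary) bricks under `Langer2004_boundedness`, whose printed proof (Langer 2022, Thm. 3.11:
Quot schemes, Castelnuovo–Mumford regularity, coherent cohomology, Bogomolov's inequality and the
restriction theorem on `𝐏ⁿ`, the Le Potier–Simpson projection) has no counterpart in Mathlib or the
tree yet: a zero `𝒪`-module is coherent, is pure of every dimension, has Hilbert polynomial `0` and
`μ̂_max ≤ μ` vacuously, so it lies in `𝒮(d; 0, μ)`; and a family all of whose members are zero — in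
particular the empty family — is bounded, by `T = Spec A` and `F = 0`. -/

section Elementary

variable {X : Scheme.{u}}

/-- The free `𝒪_X`-module on an empty set of generators is a zero object. [folklore] -/
theorem isZero_free_of_isEmpty (I : Type u) [IsEmpty I] :
    IsZero (SheafOfModules.free (R := X.ringCatSheaf) I) := by
  rw [IsZero.iff_id_eq_zero]
  exact Cofan.IsColimit.hom_ext (SheafOfModules.isColimitFreeCofan I) _ _ (fun i => isEmptyElim i)

set_option maxHeartbeats 400000 in
-- the two `change`s unfold `Presentation.quasicoherentData`/`Presentation.map` down to the index types
/-- The quasi-coherent data on the trivial cover attached to a finite global presentation of a sheaf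
of modules is a finite presentation. [folklore] -/
theorem quasicoherentData_isFinitePresentation {M : SheafOfModules.{u} X.ringCatSheaf}
    (P : SheafOfModules.Presentation M) [P.IsFinite] :
    SheafOfModules.QuasicoherentData.IsFinitePresentation.{u, u, u, u} P.quasicoherentData where
  isFinite_presentation _ :=
    { isFiniteType_generators := ⟨by
        change Finite P.generators.I
        infer_instance⟩
      isFiniteType_relations := ⟨by
        change Finite P.relations.I
        infer_instance⟩ }

/-- A zero sheaf of modules on a scheme is finitely presented: it has the global presentation with
no generators and no relations. [folklore] -/
theorem isFinitePresentation_sheafOfModules_of_isZero {M : SheafOfModules.{u} X.ringCatSheaf}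
    (hM : IsZero M) : SheafOfModules.IsFinitePresentation.{u, u, u} M := by
  let gens : SheafOfModules.GeneratingSections M :=
    { I := PEmpty, s := fun i => PEmpty.elim i, epi := hM.epi _ }
  have hker : IsZero (kernel gens.π) :=
    IsZero.of_mono (kernel.ι gens.π) (isZero_free_of_isEmpty PEmpty)
  let rels : (kernel gens.π).GeneratingSections :=
    { I := PEmpty, s := fun i => PEmpty.elim i, epi := hker.epi _ }
  let P : SheafOfModules.Presentation M := ⟨gens, rels⟩
  haveI : P.IsFinite :=
    { isFiniteType_generators := ⟨inferInstanceAs (Finite PEmpty.{u + 1})⟩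
      isFiniteType_relations := ⟨inferInstanceAs (Finite PEmpty.{u + 1})⟩ }
  exact SheafOfModules.IsFinitePresentation.mk.{u, u, u} ⟨P.quasicoherentData,
    quasicoherentData_isFinitePresentation P⟩

/-- **A zero `𝒪_X`-module is coherent** (finitely presented). [folklore] -/
theorem isFinitePresentation_of_isZero {M : X.Modules} (hM : IsZero M) :
    SheafOfModules.IsFinitePresentation.{u, u, u} M := by
  apply isFinitePresentation_sheafOfModules_of_isZero
  rwa [IsZero.iff_id_eq_zero] at hM ⊢

/-- All sections of a zero `𝒪_X`-module vanish. [folklore] -/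
theorem section_eq_zero_of_isZero {M : X.Modules} (hM : IsZero M) (U : X.Opens) (s : Γ(M, U)) :
    s = 0 := by
  have h : (𝟙 M : M ⟶ M).app U = (0 : M ⟶ M).app U := by rw [hM.eq_of_src (𝟙 M) 0]
  rw [Scheme.Modules.Hom.id_app, Scheme.Modules.Hom.zero_app] at h
  simpa using ConcreteCategory.congr_hom h s

/-- A zero `𝒪_X`-module is pure of every dimension (it has no non-zero subsheaf). [folklore] -/
theorem isPureOfDim_of_isZero {M : X.Modules} (hM : IsZero M) (d : ℕ) : IsPureOfDim M d :=
  fun _ j _ _ hF ↦ (hF (IsZero.of_mono j hM)).elim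

variable {A : Type u} [CommRing A]

/-- The sections of a zero module over an open of an `A`-scheme form a trivial `A`-module. [folklore] -/
theorem subsingleton_mSections_of_isZero {Y : Scheme.{u}} (f : Y ⟶ Spec (.of A)) {M : Y.Modules}
    (hM : IsZero M) (V : Y.Opens) : Subsingleton (MSections f M V) :=
  ⟨fun a b ↦ (section_eq_zero_of_isZero hM V a).trans (section_eq_zero_of_isZero hM V b).symm⟩

variable {K : Type u} [Field K] {N : ℕ} {Z : Scheme.{u}} (ι : Z ⟶ PP K N) (E : Z.Modules)

/-- `h⁰(Z, E(m)) = 0` for the zero sheaf `E`. [folklore] -/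
theorem h0Twist_of_isZero (hE : IsZero E) (m : ℕ) : h0Twist ι E m = 0 := by
  haveI : ∀ i : Fin (N + 1), Subsingleton (MSections (strZ ι) E (Zop ι {i})) :=
    fun i ↦ subsingleton_mSections_of_isZero (strZ ι) hE (Zop ι {i})
  exact Module.finrank_zero_of_subsingleton

/-- The zero polynomial is a Hilbert polynomial of the zero sheaf. [folklore] -/
theorem isHilbertPolynomialOf_zero_of_isZero (hE : IsZero E) : IsHilbertPolynomialOf ι E 0 :=
  Filter.Eventually.of_forall fun m ↦ by simp [h0Twist_of_isZero ι E hE m]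

/-- **The Hilbert polynomial of the zero sheaf is `0`.** [folklore] -/
theorem hilbertPolynomial_of_isZero (hE : IsZero E) : hilbertPolynomial ι E = 0 :=
  hilbertPolynomial_eq ι E (isHilbertPolynomialOf_zero_of_isZero ι E hE)

/-- `μ̂_max(0) ≤ μ` vacuously: the zero sheaf has no non-zero subsheaf. [folklore] -/
theorem maxSlopeLE_of_isZero (hE : IsZero E) (d : ℕ) (μ : ℚ) : MaxSlopeLE ι E d μ :=
  fun _ j _ _ hF ↦ (hF (IsZero.of_mono j hE)).elim

end Elementary

section ElementaryBounded

variable {A : Type u} [CommRing A] {N : ℕ} {Z : Scheme.{u}} (ι : Z ⟶ PP A N)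

/-- **The zero sheaf lies in `𝒮_{Z/A}(d; 0, μ)`** on every geometric fibre, for every `d` and `μ`:
it is coherent, pure of dimension `d`, has Hilbert polynomial `0` and `μ̂_max ≤ μ`. [folklore] -/
theorem langerFamily_of_isZero (d : ℕ) (μ : ℚ) {𝔭 : PrimeSpectrum A}
    {E : (geomFibre (geomPoint A 𝔭) ι).Modules} (hE : IsZero E) : langerFamily ι d 0 μ E :=
  ⟨isFinitePresentation_of_isZero hE, isPureOfDim_of_isZero hE d,
    hilbertPolynomial_of_isZero _ E hE, maxSlopeLE_of_isZero _ E hE d μ⟩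

variable {ι}

open ZeroObject in
/-- **A family of zero sheaves is bounded**: take `T = Spec A` (of finite type over `A`) and `F = 0`
on `Z_T`; every zero `E` on `Z_{κ(𝔭)‾}` is the pull-back of `0` at the tautological `κ(𝔭)‾`-point,
pull-back functors being additive. [folklore] -/
theorem FibreSheafFamily.isBounded_of_forall_isZero {𝓕 : FibreSheafFamily ι}
    (h : ∀ ⦃𝔭 : PrimeSpectrum A⦄ (E : (geomFibre (geomPoint A 𝔭) ι).Modules), 𝓕 E → IsZero E) :
    𝓕.IsBounded := by
  refine ⟨Spec (.of A), 𝟙 _, inferInstance, inferInstance, 0,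
    isFinitePresentation_of_isZero (isZero_zero _), fun 𝔭 E hE ↦ ?_⟩
  exact ⟨Spec.map (CommRingCat.ofHom (algebraMap A (geomPoint A 𝔭))), Category.comp_id _,
    ⟨(h E hE).iso ((Scheme.Modules.pullback _).map_isZero (isZero_zero _))⟩⟩

/-- **The empty family is bounded.** [folklore] -/
theorem FibreSheafFamily.isBounded_of_forall_not {𝓕 : FibreSheafFamily ι}
    (h : ∀ ⦃𝔭 : PrimeSpectrum A⦄ (E : (geomFibre (geomPoint A 𝔭) ι).Modules), ¬ 𝓕 E) :
    𝓕.IsBounded :=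
  FibreSheafFamily.isBounded_of_forall_isZero fun _ E hE ↦ (h E hE).elim

/-- The subfamily of `𝒮_{Z/A}(d; P, μ)` consisting of zero sheaves is bounded (for `P ≠ 0` it is
empty, for `P = 0` it is the family of all zero sheaves). [folklore] -/
theorem isBounded_langerFamily_inter_isZero (d : ℕ) (P : ℚ[X]) (μ : ℚ) :
    FibreSheafFamily.IsBounded (ι := ι) fun _ E ↦ langerFamily ι d P μ E ∧ IsZero E :=
  FibreSheafFamily.isBounded_of_forall_isZero fun _ _ hE ↦ hE.2

end ElementaryBounded

/-! ### Invariance under isomorphism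

Membership in `𝒮_{Z/A}(d; P, μ)` and boundedness only depend on isomorphism classes ("family of
isomorphism classes of coherent sheaves", Langer 2022, §3.3; Huybrechts–Lehn, Def. 1.7.5): twisted
sections, `h⁰(E(m))` and the Hilbert polynomial are functorial in `E`, purity and `μ̂_max ≤ μ` pass
along isomorphisms, and the isomorphism closure of a bounded family is bounded. -/

section IsoInvariance

variable {X : Scheme.{u}}

/-- Purity is invariant under isomorphism (subsheaves of `M'` are subsheaves of `M`). [folklore] -/
theorem IsPureOfDim.of_iso {M M' : X.Modules} {d : ℕ} (h : IsPureOfDim M d) (e : M ≅ M') :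
    IsPureOfDim M' d :=
  fun F j _ hF h0 ↦ h F (j ≫ e.inv) inferInstance hF h0

variable {K : Type u} [Field K] {N : ℕ} {Z : Scheme.{u}} (ι : Z ⟶ PP K N) {E E' E'' : Z.Modules}

/-- **Functoriality of `Γ(Z, E(m))`**: a morphism `φ : E → E'` of `𝒪_Z`-modules maps twisted
sections to twisted sections componentwise, `(s_i) ↦ (φ(s_i))` (it commutes with restriction and with
multiplication by the transition functions). [folklore] -/
def twistedSectionsMap (φ : E ⟶ E') (m : ℕ) : twistedSections ι E m →ₗ[K] twistedSections ι E' m :=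
  (LinearMap.pi fun i ↦ (MSections.app (strZ ι) φ (Zop ι {i})).comp (LinearMap.proj i)).restrict
    fun s hs i j ↦ by
      simp only [LinearMap.pi_apply, LinearMap.coe_comp, Function.comp_apply, LinearMap.coe_proj,
        Function.eval]
      rw [MSections.res_app, MSections.res_app, hs i j, MSections.app_smul]

/-- Components of `twistedSectionsMap`. [folklore] -/
@[simp] theorem twistedSectionsMap_apply (φ : E ⟶ E') (m : ℕ) (s : twistedSections ι E m)
    (i : Fin (N + 1)) :
    (twistedSectionsMap ι φ m s : ∀ i, MSections (strZ ι) E' (Zop ι {i})) i =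
      MSections.app (strZ ι) φ (Zop ι {i}) (s.1 i) :=
  rfl

/-- `twistedSectionsMap` of the identity. [folklore] -/
theorem twistedSectionsMap_id (m : ℕ) (s : twistedSections ι E m) :
    twistedSectionsMap ι (𝟙 E) m s = s := by
  apply Subtype.ext
  funext i
  rfl

/-- `twistedSectionsMap` of a composite. [folklore] -/
theorem twistedSectionsMap_comp (φ : E ⟶ E') (ψ : E' ⟶ E'') (m : ℕ) (s : twistedSections ι E m) :
    twistedSectionsMap ι (φ ≫ ψ) m s = twistedSectionsMap ι ψ m (twistedSectionsMap ι φ m s) := by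
  apply Subtype.ext
  funext i
  rfl

/-- **`Γ(Z, E(m)) ≅ Γ(Z, E'(m))` for `E ≅ E'`**, `K`-linearly. [folklore] -/
def twistedSectionsEquiv (e : E ≅ E') (m : ℕ) : twistedSections ι E m ≃ₗ[K] twistedSections ι E' m :=
  LinearEquiv.ofLinear (twistedSectionsMap ι e.hom m) (twistedSectionsMap ι e.inv m)
    (by
      ext1 s
      rw [LinearMap.comp_apply, ← twistedSectionsMap_comp, e.inv_hom_id, twistedSectionsMap_id,
        LinearMap.id_apply])
    (by
      ext1 s
      rw [LinearMap.comp_apply, ← twistedSectionsMap_comp, e.hom_inv_id, twistedSectionsMap_id,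
        LinearMap.id_apply])

/-- `h⁰(E(m))` is an isomorphism invariant. [folklore] -/
theorem h0Twist_eq_of_iso (e : E ≅ E') (m : ℕ) : h0Twist ι E m = h0Twist ι E' m :=
  (twistedSectionsEquiv ι e m).finrank_eq

/-- Hilbert polynomials (as a predicate) are isomorphism invariants. [folklore] -/
theorem IsHilbertPolynomialOf.of_iso {P : ℚ[X]} (h : IsHilbertPolynomialOf ι E P) (e : E ≅ E') :
    IsHilbertPolynomialOf ι E' P :=
  h.mono fun m hm ↦ by rw [← h0Twist_eq_of_iso ι e m, hm]

/-- **The Hilbert polynomial is an isomorphism invariant.** [folklore] -/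
theorem hilbertPolynomial_eq_of_iso (e : E ≅ E') : hilbertPolynomial ι E = hilbertPolynomial ι E' := by
  by_cases h : ∃ P : ℚ[X], IsHilbertPolynomialOf ι E P
  · obtain ⟨P, hP⟩ := h
    rw [hilbertPolynomial_eq ι E hP, hilbertPolynomial_eq ι E' (hP.of_iso ι e)]
  · rw [hilbertPolynomial_of_not_exists ι E h, hilbertPolynomial_of_not_exists ι E']
    rintro ⟨P, hP⟩
    exact h ⟨P, hP.of_iso ι e.symm⟩

/-- `μ̂_max ≤ μ` is invariant under isomorphism. [folklore] -/
theorem MaxSlopeLE.of_iso {d : ℕ} {μ : ℚ} (h : MaxSlopeLE ι E d μ) (e : E ≅ E') :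
    MaxSlopeLE ι E' d μ :=
  fun F j _ hF h0 ↦ h F (j ≫ e.inv) inferInstance hF h0

end IsoInvariance

section IsoInvarianceBounded

variable {A : Type u} [CommRing A] {N : ℕ} {Z : Scheme.{u}} (ι : Z ⟶ PP A N)

/-- **`𝒮_{Z/A}(d; P, μ)` is a family of isomorphism classes**: membership passes along
isomorphisms. [folklore] -/
theorem langerFamily_of_iso {d : ℕ} {P : ℚ[X]} {μ : ℚ} {𝔭 : PrimeSpectrum A}
    {E E' : (geomFibre (geomPoint A 𝔭) ι).Modules} (e : E ≅ E') (h : langerFamily ι d P μ E) :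
    langerFamily ι d P μ E' :=
  ⟨Literature.AlgebraicGeometry.Modules.isFinitePresentation_of_iso e h.1, h.2.1.of_iso e,
    (hilbertPolynomial_eq_of_iso _ e).symm.trans h.2.2.1, h.2.2.2.of_iso _ e⟩

variable {ι}

/-- **The isomorphism closure of a bounded family is bounded** (same `T`, same `F`). [folklore] -/
theorem FibreSheafFamily.IsBounded.isoClosure {𝓕 : FibreSheafFamily ι} (h : 𝓕.IsBounded) :
    FibreSheafFamily.IsBounded (ι := ι) fun 𝔭 E' ↦
      ∃ E : (geomFibre (geomPoint A 𝔭) ι).Modules, 𝓕 E ∧ Nonempty (E ≅ E') := by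
  obtain ⟨T, g, hg, hq, F, hF, hmem⟩ := h
  refine ⟨T, g, hg, hq, F, hF, fun 𝔭 E' hE' ↦ ?_⟩
  obtain ⟨E, hE, ⟨e⟩⟩ := hE'
  obtain ⟨t, ht, ⟨i⟩⟩ := hmem E hE
  exact ⟨t, ht, ⟨e.symm ≪≫ i⟩⟩

/-- A family is bounded as soon as every member is isomorphic to a member of a bounded family. [folklore] -/
theorem FibreSheafFamily.IsBounded.of_forall_exists_iso {𝓕 𝓖 : FibreSheafFamily ι} (h𝓖 : 𝓖.IsBounded)
    (h : ∀ ⦃𝔭 : PrimeSpectrum A⦄ (E' : (geomFibre (geomPoint A 𝔭) ι).Modules), 𝓕 E' →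
      ∃ E : (geomFibre (geomPoint A 𝔭) ι).Modules, 𝓖 E ∧ Nonempty (E ≅ E')) :
    𝓕.IsBounded :=
  h𝓖.isoClosure.anti h

end IsoInvarianceBounded

/-! ### Module lemmas for gluing along a disjoint union

Used by `FibreSheafFamily.IsBounded.union`: vanishing of sections over `∅`, of `(j₂)_* F₂` on the
image of `j₁` for disjoint open immersions, and `j₁^*((j₁)_* F₁ ⊕ (j₂)_* F₂) ≅ F₁`. -/

section ModuleLemmas

variable {X : Scheme.{u}}

/-- An `𝒪_X`-module all of whose section groups are trivial is a zero object. [folklore] -/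
theorem isZero_of_subsingleton (M : X.Modules) (h : ∀ U : X.Opens, Subsingleton Γ(M, U)) :
    IsZero M := by
  rw [IsZero.iff_id_eq_zero]
  apply Scheme.Modules.hom_ext
  intro U
  ext s
  exact Subsingleton.elim _ _

/-- Sections of an `𝒪_X`-module over the empty open are trivial (sheaf condition). [folklore] -/
theorem subsingleton_sections_bot (M : X.Modules) : Subsingleton Γ(M, (⊥ : X.Opens)) := by
  have hZ : IsZero (((⟨M.presheaf, M.isSheaf⟩ : TopCat.Sheaf Ab X.carrier)).obj.obj (op ⊥)) :=
    (TopCat.Sheaf.isTerminalOfEmpty _).isZero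
  have h := hZ.eq_of_src (𝟙 _) 0
  refine ⟨fun a b ↦ ?_⟩
  have ha : a = 0 := by simpa using ConcreteCategory.congr_hom h a
  have hb : b = 0 := by simpa using ConcreteCategory.congr_hom h b
  rw [ha, hb]

variable {X₁ X₂ : Scheme.{u}} (j₁ : X₁ ⟶ X) (j₂ : X₂ ⟶ X)

/-- For `j₁` an open immersion and `j₂` with image disjoint from `j₁`'s, `j₂⁻¹(j₁(U)) = ∅`. [folklore] -/
theorem preimage_image_eq_bot_of_disjoint [IsOpenImmersion j₁]
    (h : Disjoint (Set.range j₁) (Set.range j₂)) (U : X₁.Opens) :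
    j₂ ⁻¹ᵁ (j₁ ''ᵁ U) = ⊥ := by
  refine le_bot_iff.mp fun x hx ↦ ?_
  obtain ⟨y, -, hy⟩ := hx
  exact (Set.disjoint_iff_forall_ne.mp h ⟨y, rfl⟩ ⟨x, rfl⟩ hy).elim

/-- **`(j₂)_* F₂` vanishes on the image of `j₁`** when the images of `j₁` and `j₂` are disjoint:
`((j₂)_* F₂)|_{X₁} = 0` (its sections over `U ⊆ X₁` are `Γ(F₂, j₂⁻¹ j₁ U) = Γ(F₂, ∅) = 0`). [folklore] -/
theorem isZero_restrict_pushforward_of_disjoint [IsOpenImmersion j₁]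
    (h : Disjoint (Set.range j₁) (Set.range j₂)) (F₂ : X₂.Modules) : IsZero (((Scheme.Modules.pushforward j₂).obj F₂).restrict j₁) := by
  refine isZero_of_subsingleton _ fun U ↦ ?_
  change Subsingleton Γ(F₂, j₂ ⁻¹ᵁ (j₁ ''ᵁ U))
  rw [preimage_image_eq_bot_of_disjoint j₁ j₂ h U]
  exact subsingleton_sections_bot F₂

/-- The same for the inverse image functor `j₁^*` (isomorphic to restriction). [folklore] -/
theorem isZero_pullback_pushforward_of_disjoint [IsOpenImmersion j₁]
    (h : Disjoint (Set.range j₁) (Set.range j₂)) (F₂ : X₂.Modules) :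
    IsZero ((Scheme.Modules.pullback j₁).obj ((Scheme.Modules.pushforward j₂).obj F₂)) :=
  (isZero_restrict_pushforward_of_disjoint j₁ j₂ h F₂).of_iso
    ((Scheme.Modules.restrictFunctorIsoPullback j₁).app _).symm

/-- **Restriction of `(j₁)_* F₁ ⊕ (j₂)_* F₂` to `X₁` is `F₁`**, for open immersions `j₁ : X₁ → X`,
`j₂ : X₂ → X` with disjoint images: `j₁^*` is additive, `j₁^* (j₁)_* F₁ ≅ F₁` and
`j₁^* (j₂)_* F₂ = 0`. [folklore] -/
def pullbackBiprodPushforwardIso [IsOpenImmersion j₁] (h : Disjoint (Set.range j₁) (Set.range j₂))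
    (F₁ : X₁.Modules) (F₂ : X₂.Modules) :
    (Scheme.Modules.pullback j₁).obj
        ((Scheme.Modules.pushforward j₁).obj F₁ ⊞ (Scheme.Modules.pushforward j₂).obj F₂) ≅ F₁ :=
  letI : PreservesBinaryBiproducts (Scheme.Modules.pullback j₁) :=
    preservesBinaryBiproducts_of_preservesBinaryCoproducts _
  (Scheme.Modules.pullback j₁).mapBiprod _ _ ≪≫
    (isoBiprodZero (isZero_pullback_pushforward_of_disjoint j₁ j₂ h F₂)).symm ≪≫
      ((Scheme.Modules.restrictFunctorIsoPullback j₁).app _).symm ≪≫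
        (Scheme.Modules.restrictFunctorAdjCounitIso j₁).app F₁

/-- `(j₁)_* F₁ ⊕ (j₂)_* F₂` restricts to finitely presented modules on `X₁` (namely `F₁`). [folklore] -/
theorem isFinitePresentation_restrict_biprod [IsOpenImmersion j₁]
    (h : Disjoint (Set.range j₁) (Set.range j₂)) {F₁ : X₁.Modules} (F₂ : X₂.Modules) (hF₁ : SheafOfModules.IsFinitePresentation.{u, u, u} F₁) :
    SheafOfModules.IsFinitePresentation.{u, u, u}
      (((Scheme.Modules.pushforward j₁).obj F₁ ⊞ (Scheme.Modules.pushforward j₂).obj F₂).restrict j₁) :=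
  Literature.AlgebraicGeometry.Modules.isFinitePresentation_of_iso
    (((Scheme.Modules.restrictFunctorIsoPullback j₁).app _ ≪≫
      pullbackBiprodPushforwardIso j₁ j₂ h F₁ F₂)).symm hF₁

/-- The symmetric statement: restriction of `(j₁)_* F₁ ⊕ (j₂)_* F₂` to `X₂` is `F₂`. [folklore] -/
def pullbackBiprodPushforwardIso' [IsOpenImmersion j₂] (h : Disjoint (Set.range j₁) (Set.range j₂))
    (F₁ : X₁.Modules) (F₂ : X₂.Modules) :
    (Scheme.Modules.pullback j₂).obj
        ((Scheme.Modules.pushforward j₁).obj F₁ ⊞ (Scheme.Modules.pushforward j₂).obj F₂) ≅ F₂ :=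
  (Scheme.Modules.pullback j₂).mapIso (biprod.braiding _ _) ≪≫
    pullbackBiprodPushforwardIso j₂ j₁ h.symm F₂ F₁

/-- Symmetrically, `(j₁)_* F₁ ⊕ (j₂)_* F₂` restricts to `F₂` on `X₂`. [folklore] -/
theorem isFinitePresentation_restrict_biprod' [IsOpenImmersion j₂]
    (h : Disjoint (Set.range j₁) (Set.range j₂)) (F₁ : X₁.Modules) {F₂ : X₂.Modules} (hF₂ : SheafOfModules.IsFinitePresentation.{u, u, u} F₂) :
    SheafOfModules.IsFinitePresentation.{u, u, u}
      (((Scheme.Modules.pushforward j₁).obj F₁ ⊞ (Scheme.Modules.pushforward j₂).obj F₂).restrict j₂) :=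
  Literature.AlgebraicGeometry.Modules.isFinitePresentation_of_iso
    (((Scheme.Modules.restrictFunctorIsoPullback j₂).app _ ≪≫
      pullbackBiprodPushforwardIso' j₁ j₂ h F₁ F₂)).symm hF₂

end ModuleLemmas

/-! ### Finite unions of bounded families -/

section Union

variable {A : Type u} [CommRing A] {N : ℕ} {Z : Scheme.{u}} (ι : Z ⟶ PP A N)
  {T₁ T₂ : Scheme.{u}} (g₁ : T₁ ⟶ Spec (.of A)) (g₂ : T₂ ⟶ Spec (.of A))

/-- `Z_{T₁ ⊔ T₂} ×_{T₁ ⊔ T₂} T₁ ≅ Z_{T₁}`. [folklore] -/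
def pullbackInlIso :
    pullback (pullback.snd (strZ ι) (coprod.desc g₁ g₂)) (coprod.inl : T₁ ⟶ T₁ ⨿ T₂) ≅
      pullback (strZ ι) g₁ :=
  pullbackLeftPullbackSndIso (strZ ι) (coprod.desc g₁ g₂) coprod.inl ≪≫
    pullback.congrHom rfl (coprod.inl_desc g₁ g₂)

/-- `Z_{T₁ ⊔ T₂} ×_{T₁ ⊔ T₂} T₂ ≅ Z_{T₂}`. [folklore] -/
def pullbackInrIso :
    pullback (pullback.snd (strZ ι) (coprod.desc g₁ g₂)) (coprod.inr : T₂ ⟶ T₁ ⨿ T₂) ≅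
      pullback (strZ ι) g₂ :=
  pullbackLeftPullbackSndIso (strZ ι) (coprod.desc g₁ g₂) coprod.inr ≪≫
    pullback.congrHom rfl (coprod.inr_desc g₁ g₂)

/-- The open immersion `Z_{T₁} ↪ Z_{T₁ ⊔ T₂}`. [folklore] -/
def unionInl : pullback (strZ ι) g₁ ⟶ pullback (strZ ι) (coprod.desc g₁ g₂) :=
  (pullbackInlIso ι g₁ g₂).inv ≫ pullback.fst _ _

/-- The open immersion `Z_{T₂} ↪ Z_{T₁ ⊔ T₂}`. [folklore] -/
def unionInr : pullback (strZ ι) g₂ ⟶ pullback (strZ ι) (coprod.desc g₁ g₂) :=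
  (pullbackInrIso ι g₁ g₂).inv ≫ pullback.fst _ _

/-- `Z_{T₁} ↪ Z_{T₁ ⊔ T₂}` is an open immersion (base change of `T₁ ↪ T₁ ⊔ T₂`). [folklore] -/
instance : IsOpenImmersion (unionInl ι g₁ g₂) := by
  unfold unionInl; infer_instance

/-- `Z_{T₂} ↪ Z_{T₁ ⊔ T₂}` is an open immersion (base change of `T₂ ↪ T₁ ⊔ T₂`). [folklore] -/
instance : IsOpenImmersion (unionInr ι g₁ g₂) := by
  unfold unionInr; infer_instance

/-- `Z_{T₁} ↪ Z_{T₁ ⊔ T₂}` commutes with the projections to `Z`. [folklore] -/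
@[reassoc (attr := simp)]
theorem unionInl_fst :
    unionInl ι g₁ g₂ ≫ pullback.fst (strZ ι) (coprod.desc g₁ g₂) = pullback.fst (strZ ι) g₁ := by
  simp only [unionInl, pullbackInlIso, Iso.trans_inv, Category.assoc,
    pullbackLeftPullbackSndIso_inv_fst, pullback.congrHom_inv, pullback.lift_fst, Category.comp_id]

/-- `Z_{T₁} ↪ Z_{T₁ ⊔ T₂}` lies over `T₁ ↪ T₁ ⊔ T₂`. [folklore] -/
@[reassoc (attr := simp)]
theorem unionInl_snd :
    unionInl ι g₁ g₂ ≫ pullback.snd (strZ ι) (coprod.desc g₁ g₂) =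
      pullback.snd (strZ ι) g₁ ≫ coprod.inl := by
  simp only [unionInl, pullbackInlIso, Iso.trans_inv, Category.assoc,
    pullbackLeftPullbackSndIso_inv_fst_snd, pullback.congrHom_inv, pullback.lift_snd_assoc,
    Category.comp_id]

/-- `Z_{T₂} ↪ Z_{T₁ ⊔ T₂}` commutes with the projections to `Z`. [folklore] -/
@[reassoc (attr := simp)]
theorem unionInr_fst :
    unionInr ι g₁ g₂ ≫ pullback.fst (strZ ι) (coprod.desc g₁ g₂) = pullback.fst (strZ ι) g₂ := by
  simp only [unionInr, pullbackInrIso, Iso.trans_inv, Category.assoc,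
    pullbackLeftPullbackSndIso_inv_fst, pullback.congrHom_inv, pullback.lift_fst, Category.comp_id]

/-- `Z_{T₂} ↪ Z_{T₁ ⊔ T₂}` lies over `T₂ ↪ T₁ ⊔ T₂`. [folklore] -/
@[reassoc (attr := simp)]
theorem unionInr_snd :
    unionInr ι g₁ g₂ ≫ pullback.snd (strZ ι) (coprod.desc g₁ g₂) =
      pullback.snd (strZ ι) g₂ ≫ coprod.inr := by
  simp only [unionInr, pullbackInrIso, Iso.trans_inv, Category.assoc,
    pullbackLeftPullbackSndIso_inv_fst_snd, pullback.congrHom_inv, pullback.lift_snd_assoc,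
    Category.comp_id]

/-- `Z_{T₁}` and `Z_{T₂}` are disjoint in `Z_{T₁ ⊔ T₂}` (they lie over `T₁`, `T₂`). [folklore] -/
theorem disjoint_range_unionInl_unionInr :
    Disjoint (Set.range (unionInl ι g₁ g₂)) (Set.range (unionInr ι g₁ g₂)) := by
  refine Set.disjoint_iff_forall_ne.mpr ?_
  rintro _ ⟨a, rfl⟩ _ ⟨b, rfl⟩ hab
  have h₁ : (pullback.snd (strZ ι) (coprod.desc g₁ g₂)) (unionInl ι g₁ g₂ a) =
      (coprod.inl : T₁ ⟶ T₁ ⨿ T₂) (pullback.snd (strZ ι) g₁ a) := by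
    rw [← Scheme.Hom.comp_apply, unionInl_snd, Scheme.Hom.comp_apply]
  have h₂ : (pullback.snd (strZ ι) (coprod.desc g₁ g₂)) (unionInr ι g₁ g₂ b) =
      (coprod.inr : T₂ ⟶ T₁ ⨿ T₂) (pullback.snd (strZ ι) g₂ b) := by
    rw [← Scheme.Hom.comp_apply, unionInr_snd, Scheme.Hom.comp_apply]
  rw [hab, h₂] at h₁
  exact inr_ne_inl _ _ _ _ h₁

/-- The open cover of `Z_{T₁ ⊔ T₂}` by `Z_{T₁}` and `Z_{T₂}` (pull-back of the cover of `T₁ ⊔ T₂`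
by its two summands). [folklore] -/
def unionCover : (pullback (strZ ι) (coprod.desc g₁ g₂)).OpenCover :=
  Scheme.Cover.copy ((coprodOpenCover.{u} T₁ T₂).pullback₁ (pullback.snd (strZ ι) (coprod.desc g₁ g₂)))
    (PUnit.{u + 1} ⊕ PUnit.{u + 1})
    (fun i ↦ Sum.elim (fun _ ↦ pullback (strZ ι) g₁) (fun _ ↦ pullback (strZ ι) g₂) i)
    (fun i ↦ match i with
      | Sum.inl _ => unionInl ι g₁ g₂
      | Sum.inr _ => unionInr ι g₁ g₂)
    (Equiv.refl _)
    (fun i ↦ match i with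
      | Sum.inl _ => (pullbackInlIso ι g₁ g₂).symm
      | Sum.inr _ => (pullbackInrIso ι g₁ g₂).symm)
    (fun i ↦ match i with
      | Sum.inl _ => rfl
      | Sum.inr _ => rfl)

variable (F₁ : (pullback (strZ ι) g₁).Modules) (F₂ : (pullback (strZ ι) g₂).Modules)

/-- **The sheaf on `Z_{T₁ ⊔ T₂}` glued from `F₁` on `Z_{T₁}` and `F₂` on `Z_{T₂}`**: the direct
sum of their extensions by zero `(j₁)_* F₁ ⊕ (j₂)_* F₂`. [folklore] -/
abbrev unionSheaf : (pullback (strZ ι) (coprod.desc g₁ g₂)).Modules :=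
  (Scheme.Modules.pushforward (unionInl ι g₁ g₂)).obj F₁ ⊞
    (Scheme.Modules.pushforward (unionInr ι g₁ g₂)).obj F₂

variable {F₁ F₂} in
/-- The glued sheaf is coherent if the pieces are. [folklore] -/
theorem isFinitePresentation_unionSheaf (hF₁ : SheafOfModules.IsFinitePresentation.{u, u, u} F₁)
    (hF₂ : SheafOfModules.IsFinitePresentation.{u, u, u} F₂) :
    SheafOfModules.IsFinitePresentation.{u, u, u} (unionSheaf ι g₁ g₂ F₁ F₂) := by
  refine Literature.AlgebraicGeometry.Modules.isFinitePresentation_of_openCover _ (unionCover ι g₁ g₂) ?_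
  rintro (u | u)
  · exact isFinitePresentation_restrict_biprod _ _ (disjoint_range_unionInl_unionInr ι g₁ g₂) F₂ hF₁
  · exact isFinitePresentation_restrict_biprod' _ _ (disjoint_range_unionInl_unionInr ι g₁ g₂) F₁ hF₂

variable {ι}

/-- **A finite union of bounded families is bounded**: for `(T₁, F₁)` bounding `𝓕` and `(T₂, F₂)`
bounding `𝓖`, the pair `(T₁ ⊔ T₂, (j₁)_* F₁ ⊕ (j₂)_* F₂)` bounds `𝓕 ∪ 𝓖` (Huybrechts–Lehn, proof of
Lemma 1.7.6 / Langer 2022 §3.3 use this freely). [folklore] -/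
theorem FibreSheafFamily.IsBounded.union {𝓕 𝓖 : FibreSheafFamily ι} (h𝓕 : 𝓕.IsBounded)
    (h𝓖 : 𝓖.IsBounded) : FibreSheafFamily.IsBounded (ι := ι) fun _ E ↦ 𝓕 E ∨ 𝓖 E := by
  obtain ⟨T₁, g₁, hl₁, hq₁, F₁, hF₁, hmem₁⟩ := h𝓕
  obtain ⟨T₂, g₂, hl₂, hq₂, F₂, hF₂, hmem₂⟩ := h𝓖
  refine ⟨T₁ ⨿ T₂, coprod.desc g₁ g₂, ?_, ?_, unionSheaf ι g₁ g₂ F₁ F₂,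
    isFinitePresentation_unionSheaf ι g₁ g₂ hF₁ hF₂, ?_⟩
  · refine IsZariskiLocalAtSource.of_openCover (P := @LocallyOfFiniteType)
      (coprodOpenCover.{u, u} T₁ T₂) ?_
    rintro (u | u)
    · change LocallyOfFiniteType (coprod.inl ≫ coprod.desc g₁ g₂)
      rw [coprod.inl_desc]
      exact hl₁
    · change LocallyOfFiniteType (coprod.inr ≫ coprod.desc g₁ g₂)
      rw [coprod.inr_desc]
      exact hl₂
  · haveI : CompactSpace T₁ := (HasAffineProperty.iff_of_isAffine (P := @QuasiCompact)).mp hq₁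
    haveI : CompactSpace T₂ := (HasAffineProperty.iff_of_isAffine (P := @QuasiCompact)).mp hq₂
    haveI : CompactSpace ↑(T₁ ⨿ T₂) := (coprodMk T₁ T₂).compactSpace
    exact (HasAffineProperty.iff_of_isAffine (P := @QuasiCompact)).mpr ‹_›
  · rintro 𝔭 E (hE | hE)
    · obtain ⟨t₁, ht₁, ⟨i₁⟩⟩ := hmem₁ E hE
      have ht : (t₁ ≫ coprod.inl) ≫ coprod.desc g₁ g₂ =
          Spec.map (CommRingCat.ofHom (algebraMap A (geomPoint A 𝔭))) := by
        rw [Category.assoc, coprod.inl_desc, ht₁]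
      refine ⟨t₁ ≫ coprod.inl, ht, ⟨?_⟩⟩
      have hfac : geomFibreTo ι (t₁ ≫ coprod.inl) ht = geomFibreTo ι t₁ ht₁ ≫ unionInl ι g₁ g₂ := by
        apply pullback.hom_ext
        · simp only [geomFibreTo_fst, Category.assoc, unionInl_fst]
        · have h' := (geomFibreTo_snd ι t₁ ht₁) =≫ (coprod.inl : T₁ ⟶ T₁ ⨿ T₂)
          simp only [Category.assoc] at h'
          simp only [geomFibreTo_snd, Category.assoc, unionInl_snd, h']
      exact i₁ ≪≫ ((Scheme.Modules.pullback _).mapIso (pullbackBiprodPushforwardIso _ _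
          (disjoint_range_unionInl_unionInr ι g₁ g₂) F₁ F₂)).symm ≪≫
        (Scheme.Modules.pullbackComp _ _).app _ ≪≫ ((Scheme.Modules.pullbackCongr hfac).app _).symm
    · obtain ⟨t₂, ht₂, ⟨i₂⟩⟩ := hmem₂ E hE
      have ht : (t₂ ≫ coprod.inr) ≫ coprod.desc g₁ g₂ =
          Spec.map (CommRingCat.ofHom (algebraMap A (geomPoint A 𝔭))) := by
        rw [Category.assoc, coprod.inr_desc, ht₂]
      refine ⟨t₂ ≫ coprod.inr, ht, ⟨?_⟩⟩
      have hfac : geomFibreTo ι (t₂ ≫ coprod.inr) ht = geomFibreTo ι t₂ ht₂ ≫ unionInr ι g₁ g₂ := by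
        apply pullback.hom_ext
        · simp only [geomFibreTo_fst, Category.assoc, unionInr_fst]
        · have h' := (geomFibreTo_snd ι t₂ ht₂) =≫ (coprod.inr : T₂ ⟶ T₁ ⨿ T₂)
          simp only [Category.assoc] at h'
          simp only [geomFibreTo_snd, Category.assoc, unionInr_snd, h']
      exact i₂ ≪≫ ((Scheme.Modules.pullback _).mapIso (pullbackBiprodPushforwardIso' _ _
          (disjoint_range_unionInl_unionInr ι g₁ g₂) F₁ F₂)).symm ≪≫
        (Scheme.Modules.pullbackComp _ _).app _ ≪≫ ((Scheme.Modules.pullbackCongr hfac).app _).symm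

/-- Bounded families are closed under binary union (pointwise `⊔` form). [folklore] -/
theorem FibreSheafFamily.IsBounded.sup {𝓕 𝓖 : FibreSheafFamily ι} (h𝓕 : 𝓕.IsBounded)
    (h𝓖 : 𝓖.IsBounded) :
    FibreSheafFamily.IsBounded (ι := ι) fun 𝔭 ↦ (𝓕 (𝔭 := 𝔭) ⊔ 𝓖 (𝔭 := 𝔭)) :=
  h𝓕.union h𝓖

/-- Reindexing a union of families along an equivalence does not change it. [folklore] -/
theorem FibreSheafFamily.isBounded_iUnion_iff_of_equiv {J J' : Type*} (e : J ≃ J')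
    (𝓕 : J' → FibreSheafFamily ι) :
    FibreSheafFamily.IsBounded (ι := ι) (fun _ E ↦ ∃ j, 𝓕 (e j) E) ↔
      FibreSheafFamily.IsBounded (ι := ι) fun _ E ↦ ∃ j, 𝓕 j E :=
  ⟨fun h ↦ h.anti fun _ E ⟨j, hj⟩ ↦ ⟨e.symm j, by simpa using hj⟩,
    fun h ↦ h.anti fun _ E ⟨j, hj⟩ ↦ ⟨e j, hj⟩⟩

/-- **Finite unions of bounded families are bounded** (induction on the finite index type from the
empty family and binary unions). [folklore] -/
theorem FibreSheafFamily.isBounded_iUnion {J : Type*} [Finite J] {𝓕 : J → FibreSheafFamily ι}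
    (h : ∀ j, (𝓕 j).IsBounded) : FibreSheafFamily.IsBounded (ι := ι) fun _ E ↦ ∃ j, 𝓕 j E := by
  induction J using Finite.induction_empty_option with
  | of_equiv e ih =>
    rw [← FibreSheafFamily.isBounded_iUnion_iff_of_equiv e]
    exact ih fun j ↦ h (e j)
  | h_empty => exact FibreSheafFamily.isBounded_of_forall_not fun _ E ⟨j, _⟩ ↦ isEmptyElim j
  | h_option ih =>
    refine ((h none).union (ih fun j ↦ h (some j))).anti fun _ E ↦ ?_
    rintro ⟨_ | j, hj⟩
    · exact Or.inl hj
    · exact Or.inr ⟨j, hj⟩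

end Union

end Literature.AlgebraicGeometry.ModuliOfSheaves

end
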